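import Mathlib
import Literature.AlgebraicGeometry.Ramification.InertiaNormalSylow
import HarnessLib

/-!
# The normal Phase-0 model maps equivariantly to `X′` (crux `WildQuotients.WildQuotientResolution`, step R2a)

Crux stmt-ResolutionOfSingularities-15640 (`WildQuotientResolution`), line `Sketch`, registered stub
`stub_phaseZeroHighDim`. After ✓`QuotientPhaseZeroNormal.exists_admissibleBlowup_glued_forall_hasNormalSylow`
(conditional on AS2011 Prop. 2.22) the candidate NORMAL Phase-0 model is the integral closure
`Y″ = f′.normalization` of the blown-up quotient `Q′ → Q = X/G` in the `G`-stable open `V = π⁻¹W ⊆ X`.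
This file gives the morphism `Y″ → X` the stub needs (its `π : Xs → X′`), by the universal property of
relative normalisation (Mathlib `Scheme.Hom.normalizationDesc`, Stacks 035I) through the INTEGRAL
`X ×_Q Q′ → Q′` (base change of the finite quotient map `π : X → Q`):

* `exists_equivariant_hom_normalization` — a morphism `Y″ → X` (through `X ×_Q Q′`) which restricts to
  the inclusion `V ↪ X` along `V → Y″` (the birationality clause), lies over `Y″ → Q′ → Q`, and is
  `G`-EQUIVARIANT for the induced action on `Y″` (the tree's `normalizationAction`, AS2011 2.4) and the
  given action on `X` (uniqueness `Scheme.Hom.normalization.hom_ext`). Def-free (an existential), so that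
  no new definition enters `Theorems/`.

What this does NOT give (census R2b/R3 of memo PHASE0-AS2011-v3.md): PROPERNESS of `Y″ → X` (it is
integral; finite type needs finiteness of integral closure = Nagata/universally Japanese, not in the tree
at scheme level) and REGULARITY of a model dominating `Y″` (open in dimension `≥ 4`).

[OURS · crux stmt-ResolutionOfSingularities-15640 · helper toward `stub_phaseZeroHighDim`; folklore
(Stacks 035I), counted 0; AI-level work, weaker than expert review.]
-/

-- single-problem summit: the doubled namespace component `ResolutionOfSingularities` is forced
set_option linter.dupNamespace false

noncomputable section

universe u

open CategoryTheory CategoryTheory.Limits AlgebraicGeometry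
open Literature.AlgebraicGeometry.Ramification

namespace Summit.ResolutionOfSingularities.ResolutionOfSingularities.Theorems.WildQuotientResolution.NormalizationToBase

variable {V X Q Q' : Scheme.{u}} (ι : V ⟶ X) (π : X ⟶ Q) [IsIntegralHom π] (φ : Q' ⟶ Q)
  (f' : V ⟶ Q') [QuasiCompact f'] [QuasiSeparated f']


/-- **The `G`-equivariant morphism `Y″ = f′.normalization → X`.** For `ι : V → X`, an INTEGRAL (e.g.
finite) `G`-invariant `π : X → Q`, `φ : Q′ → Q`, and a qcqs `f′ : V → Q′` with `ι ≫ π = f′ ≫ φ`, `G` acting on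
`V` over `Q′` (`σ`) and on `X` (`ρ`) with `ι` equivariant: there is a morphism `πs : Y″ → X` from the
relative normalisation `Y″` of `Q′` in `V` which (1) restricts to `ι` along `V → Y″`, (2) lies over
`Y″ → Q′ → Q`, and (3) is `G`-EQUIVARIANT for the induced action `normalizationAction f′ σ _` on `Y″`
(AS2011 2.4). Construction: the universal property of relative normalisation (Mathlib
`Scheme.Hom.normalizationDesc`, Stacks 035I) applied to `V → X ×_Q Q′ → Q′`, whose second map is integral
(base change of `π`), followed by the first projection; equivariance by the uniqueness half
(`Scheme.Hom.normalization.hom_ext`): `g ≫ (Y″ → X ×_Q Q′)` and `(Y″ → X ×_Q Q′) ≫ (g × 1)` are maps over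
`Q′` agreeing on `V`. [cite: StacksProject, Tag 035I] [cite: AbbesSaito2011, 2.4] -/
theorem exists_equivariant_hom_normalization (h : ι ≫ π = f' ≫ φ) {G : Type*} [Group G]
    (σ : G →* Aut V) (ρ : G →* Aut X)
    (hσ : ∀ g : G, (σ g).hom ≫ f' = f') (hρ : ∀ g : G, (ρ g).hom ≫ π = π)
    (hι : ∀ g : G, (σ g).hom ≫ ι = ι ≫ (ρ g).hom) :
    ∃ πs : f'.normalization ⟶ X, f'.toNormalization ≫ πs = ι ∧ πs ≫ π = f'.fromNormalization ≫ φ ∧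
      ∀ g : G, (normalizationAction f' σ hσ g).hom ≫ πs = πs ≫ (ρ g).hom := by
  set d := f'.normalizationDesc (pullback.lift ι f' h) (pullback.snd π φ) (by rw [pullback.lift_snd])
    with hd
  refine ⟨d ≫ pullback.fst π φ, ?_, ?_, fun g => ?_⟩
  · rw [hd, Scheme.Hom.toNormalization_normalizationDesc_assoc, pullback.lift_fst]
  · rw [Category.assoc, pullback.condition, hd, Scheme.Hom.normalizationDesc_comp_assoc]
  -- the action on `T = X ×_Q Q′`
  let tg : pullback π φ ⟶ pullback π φ :=
    pullback.map π φ π φ (ρ g).hom (𝟙 Q') (𝟙 Q) (by rw [Category.comp_id, hρ g])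
      (by rw [Category.comp_id, Category.id_comp])
  have htg₁ : tg ≫ pullback.fst π φ = pullback.fst π φ ≫ (ρ g).hom := pullback.lift_fst _ _ _
  have htg₂ : tg ≫ pullback.snd π φ = pullback.snd π φ := by
    rw [pullback.lift_snd, Category.comp_id]
  -- the two maps `Y″ → T` over `Q′` agree on `V`
  have key : (normalizationAction f' σ hσ g).hom ≫ d = d ≫ tg := by
    apply Scheme.Hom.normalization.hom_ext f' _ _ (pullback.snd π φ)
    · rw [toNormalization_normalizationAction_hom_assoc, hd, Scheme.Hom.toNormalization_normalizationDesc,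
        Scheme.Hom.toNormalization_normalizationDesc_assoc]
      apply pullback.hom_ext
      · rw [Category.assoc, pullback.lift_fst, Category.assoc, htg₁, pullback.lift_fst_assoc, hι g]
      · rw [Category.assoc, pullback.lift_snd, Category.assoc, htg₂, pullback.lift_snd, hσ g]
    · rw [Category.assoc, hd, Scheme.Hom.normalizationDesc_comp, normalizationAction_hom_fromNormalization]
    · rw [Category.assoc, htg₂, hd, Scheme.Hom.normalizationDesc_comp]
  rw [← Category.assoc, key, Category.assoc, htg₁, Category.assoc]

/-- **The same, recording separatedness.** If moreover `φ : Q′ → Q` is separated (e.g. a blow-up), the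
morphism `πs : Y″ → X` of `exists_equivariant_hom_normalization` may be chosen SEPARATED: it is the
composite of the integral (hence affine, separated) `Y″ → X ×_Q Q′` and the base change `X ×_Q Q′ → X` of
`φ`. (Used with ✓`BirationalOfSection.isBirational_of_section` to get `IsBirational πs`.)
[cite: StacksProject, Tag 035I] [cite: AbbesSaito2011, 2.4] -/
theorem exists_equivariant_isSeparated_hom_normalization [IsSeparated φ] (h : ι ≫ π = f' ≫ φ)
    {G : Type*} [Group G] (σ : G →* Aut V) (ρ : G →* Aut X)
    (hσ : ∀ g : G, (σ g).hom ≫ f' = f') (hρ : ∀ g : G, (ρ g).hom ≫ π = π)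
    (hι : ∀ g : G, (σ g).hom ≫ ι = ι ≫ (ρ g).hom) :
    ∃ πs : f'.normalization ⟶ X, IsSeparated πs ∧ f'.toNormalization ≫ πs = ι ∧
      πs ≫ π = f'.fromNormalization ≫ φ ∧
      ∀ g : G, (normalizationAction f' σ hσ g).hom ≫ πs = πs ≫ (ρ g).hom := by
  set d := f'.normalizationDesc (pullback.lift ι f' h) (pullback.snd π φ) (by rw [pullback.lift_snd])
    with hd
  haveI : IsSeparated (pullback.fst π φ) := MorphismProperty.pullback_fst _ _ inferInstance
  refine ⟨d ≫ pullback.fst π φ, inferInstance, ?_, ?_, fun g => ?_⟩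
  · rw [hd, Scheme.Hom.toNormalization_normalizationDesc_assoc, pullback.lift_fst]
  · rw [Category.assoc, pullback.condition, hd, Scheme.Hom.normalizationDesc_comp_assoc]
  -- the action on `T = X ×_Q Q′`
  let tg : pullback π φ ⟶ pullback π φ :=
    pullback.map π φ π φ (ρ g).hom (𝟙 Q') (𝟙 Q) (by rw [Category.comp_id, hρ g])
      (by rw [Category.comp_id, Category.id_comp])
  have htg₁ : tg ≫ pullback.fst π φ = pullback.fst π φ ≫ (ρ g).hom := pullback.lift_fst _ _ _
  have htg₂ : tg ≫ pullback.snd π φ = pullback.snd π φ := by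
    rw [pullback.lift_snd, Category.comp_id]
  have key : (normalizationAction f' σ hσ g).hom ≫ d = d ≫ tg := by
    apply Scheme.Hom.normalization.hom_ext f' _ _ (pullback.snd π φ)
    · rw [toNormalization_normalizationAction_hom_assoc, hd, Scheme.Hom.toNormalization_normalizationDesc,
        Scheme.Hom.toNormalization_normalizationDesc_assoc]
      apply pullback.hom_ext
      · rw [Category.assoc, pullback.lift_fst, Category.assoc, htg₁, pullback.lift_fst_assoc, hι g]
      · rw [Category.assoc, pullback.lift_snd, Category.assoc, htg₂, pullback.lift_snd, hσ g]
    · rw [Category.assoc, hd, Scheme.Hom.normalizationDesc_comp, normalizationAction_hom_fromNormalization]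
    · rw [Category.assoc, htg₂, hd, Scheme.Hom.normalizationDesc_comp]
  rw [← Category.assoc, key, Category.assoc, htg₁, Category.assoc]

/-- **The same, recording properness when the normalisation is finite.** If `φ : Q′ → Q` is proper (a
blow-up in a finite-type ideal) and the relative normalisation `Y″ → Q′` is FINITE (finiteness of integral
closure: E. Noether / Nagata, the tree's named fact `Resolution.NoetherFiniteIntegralClosure` territory), the
morphism `πs : Y″ → X` may be chosen PROPER: `Y″ → X ×_Q Q′` is proper (its composite with the separated
`X ×_Q Q′ → Q′` is the finite `Y″ → Q′`, Mathlib `IsProper.of_comp`) and `X ×_Q Q′ → X` is a base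
change of `φ`. [cite: StacksProject, Tag 035I] [cite: AbbesSaito2011, 2.4] -/
theorem exists_equivariant_isProper_hom_normalization [IsProper φ] [IsFinite f'.fromNormalization]
    (h : ι ≫ π = f' ≫ φ) {G : Type*} [Group G] (σ : G →* Aut V) (ρ : G →* Aut X)
    (hσ : ∀ g : G, (σ g).hom ≫ f' = f') (hρ : ∀ g : G, (ρ g).hom ≫ π = π)
    (hι : ∀ g : G, (σ g).hom ≫ ι = ι ≫ (ρ g).hom) :
    ∃ πs : f'.normalization ⟶ X, IsProper πs ∧ f'.toNormalization ≫ πs = ι ∧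
      πs ≫ π = f'.fromNormalization ≫ φ ∧
      ∀ g : G, (normalizationAction f' σ hσ g).hom ≫ πs = πs ≫ (ρ g).hom := by
  set d := f'.normalizationDesc (pullback.lift ι f' h) (pullback.snd π φ) (by rw [pullback.lift_snd])
    with hd
  haveI : IsProper (pullback.fst π φ) := MorphismProperty.pullback_fst _ _ inferInstance
  haveI : IsProper (d ≫ pullback.snd π φ) := by
    rw [hd, Scheme.Hom.normalizationDesc_comp]; infer_instance
  haveI : IsProper d := IsProper.of_comp d (pullback.snd π φ)
  refine ⟨d ≫ pullback.fst π φ, inferInstance, ?_, ?_, fun g => ?_⟩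
  · rw [hd, Scheme.Hom.toNormalization_normalizationDesc_assoc, pullback.lift_fst]
  · rw [Category.assoc, pullback.condition, hd, Scheme.Hom.normalizationDesc_comp_assoc]
  -- the action on `T = X ×_Q Q′`
  let tg : pullback π φ ⟶ pullback π φ :=
    pullback.map π φ π φ (ρ g).hom (𝟙 Q') (𝟙 Q) (by rw [Category.comp_id, hρ g])
      (by rw [Category.comp_id, Category.id_comp])
  have htg₁ : tg ≫ pullback.fst π φ = pullback.fst π φ ≫ (ρ g).hom := pullback.lift_fst _ _ _
  have htg₂ : tg ≫ pullback.snd π φ = pullback.snd π φ := by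
    rw [pullback.lift_snd, Category.comp_id]
  have key : (normalizationAction f' σ hσ g).hom ≫ d = d ≫ tg := by
    apply Scheme.Hom.normalization.hom_ext f' _ _ (pullback.snd π φ)
    · rw [toNormalization_normalizationAction_hom_assoc, hd, Scheme.Hom.toNormalization_normalizationDesc,
        Scheme.Hom.toNormalization_normalizationDesc_assoc]
      apply pullback.hom_ext
      · rw [Category.assoc, pullback.lift_fst, Category.assoc, htg₁, pullback.lift_fst_assoc, hι g]
      · rw [Category.assoc, pullback.lift_snd, Category.assoc, htg₂, pullback.lift_snd, hσ g]
    · rw [Category.assoc, hd, Scheme.Hom.normalizationDesc_comp, normalizationAction_hom_fromNormalization]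
    · rw [Category.assoc, htg₂, hd, Scheme.Hom.normalizationDesc_comp]
  rw [← Category.assoc, key, Category.assoc, htg₁, Category.assoc]

end Summit.ResolutionOfSingularities.ResolutionOfSingularities.Theorems.WildQuotientResolution.NormalizationToBase

end
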